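import Summits.BirchSwinnertonDyer.BirchSwinnertonDyer.Theorems.AlignedTransportAtTwoMainConjectureTransportAlignedAtTwoAlignedAtTwoCongruence
import Summits.BirchSwinnertonDyer.BirchSwinnertonDyer.Theorems.AlignedTransportAtTwoMainConjectureTransportAlignedAtTwoRungCell6213a
import Summits.BirchSwinnertonDyer.BirchSwinnertonDyer.Theorems.AlignedTransportAtTwoCertifiedSeedsRowsB
import Summits.BirchSwinnertonDyer.BirchSwinnertonDyer.Theorems.AlignedTransportAtTwoMainConjectureTransportAlignedAtTwoAlignedAtInfinityNegDisc
import Summits.BirchSwinnertonDyer.BirchSwinnertonDyer.Theorems.AlignedTransportAtTwoMainConjectureTransportAlignedAtTwoTwistKidaCellM1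
import HarnessLib
import Summits.BirchSwinnertonDyer.BirchSwinnertonDyer.Theorems.ByReductionTypeAtTwoTowerClass10913b
import Summits.BirchSwinnertonDyer.BirchSwinnertonDyer.Theorems.ByReductionTypeAtTwoTowerClass17671a
import Summits.BirchSwinnertonDyer.BirchSwinnertonDyer.Theorems.ByReductionTypeAtTwoTowerClass21765d
import Summits.BirchSwinnertonDyer.BirchSwinnertonDyer.Theorems.ByReductionTypeAtTwoTowerClass29359b
import Summits.BirchSwinnertonDyer.BirchSwinnertonDyer.Theorems.ByReductionTypeAtTwoTowerClass29359d

/-!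
# Route `AlignedTransportAtTwo`, (γ) rows / cell′ of crux C2 `MainConjectureOfRankZeroBSDAtTwo` (stmt-BirchSwinnertonDyer-22298):
# the two cell′ SEED binders `Δ′ < 0` (⟹ `Δ′ ∉ ℚ²`) and `¬ HasCM` for the five UNCERTIFIED census seeds `10913b1, 17671a1, 21765d1, 29359b1, 29359d1`

WIDTH-5 attach seat `bsd-line-att-p3` g24 (cell `bsd-f1-sign2`); `--supports stmt-BirchSwinnertonDyer-22298 --as helper`.
THEOREMS ONLY — no `def`, no named fact, no `sorry`. BSD is NOT proved; no crux is closed. Companion of `…AlignedPairSeeds` (p742533,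
the eleven certified seeds): these five seeds of D-imc-12 have NO tower-gap certificate at layers `≤ 3` (`TURNKEY-SEEDS-v2`: «NOT at j≤3»),
so their targets enter cell′ (`AlignedSeedCellAtTwo`) but not the certified cell″; the binders are the ones the cell predicate asks of the
seed beyond the kernel facts of `Theorems/ByReductionTypeAtTwoTowerClass<seed>.lean`: `Δ′ < 0` (model), `¬ CM` (`gcd(Δ′, c₄′) = 1` ⟹
`Δ′ ∤ c₄′³` ⟹ `j ∉ ℤ`, tree `OrdRedAtTwo.not_hasCM_baseChange_int_of_not_dvd_c₄_pow`).

References: [CremonaAlgorithms1997] Table 1; [SilvermanATAEC1994] Thm. II.6.1.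
-/

set_option autoImplicit false
-- `….BirchSwinnertonDyer.BirchSwinnertonDyer.…` is the summit/sub-problem namespace (D-0017): dupNamespace is intended.
set_option linter.dupNamespace false

noncomputable section

open scoped Classical MatrixGroups ModularForm

open NumberField IsDedekindDomain CongruenceSubgroup WeierstrassCurve Polynomial
open Literature.NumberTheory.EllipticCurves Literature.NumberTheory.EllipticCurves.ModularForms
open Literature.NumberTheory.EllipticCurves.Rank1Residual Literature.NumberTheory.EllipticCurves.Rank1Residual.Typed
open Literature.NumberTheory.EllipticCurves.Greenberg1999
open Summit.BirchSwinnertonDyer.Rank1Residual Summit.BirchSwinnertonDyer.Rank1Residual.F1Sign2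
open Summit.BirchSwinnertonDyer.Rank1Residual.X1.MuLambda
open Summit.BirchSwinnertonDyer.Rank1Residual.X5 Summit.BirchSwinnertonDyer.Rank1Residual.X5.O1
open Summit.BirchSwinnertonDyer.Rank1Residual.X5.Instances
open Summit.BirchSwinnertonDyer.BirchSwinnertonDyer.Theorems.KatoHalfPinch
open Summit.BirchSwinnertonDyer.BirchSwinnertonDyer.Theorems.Rank1ResidualX1Defs
open Summit.BirchSwinnertonDyer.BirchSwinnertonDyer.Theses.AlignedTransportAtTwo
open Summit.BirchSwinnertonDyer.BirchSwinnertonDyer.Theorems.TowerClass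
open Summit.BirchSwinnertonDyer.BirchSwinnertonDyer.Theorems.AlignedTransportAtTwoRungCell
open Summit.BirchSwinnertonDyer.BirchSwinnertonDyer.Theorems.AlignedTransportAtTwoRungDefs
open Summit.BirchSwinnertonDyer.BirchSwinnertonDyer.Theorems.AlignedTransportAtTwoRungSplit
open Summit.BirchSwinnertonDyer.BirchSwinnertonDyer.Theorems.AlignedTransportAtTwoCertifiedSeeds
open Summit.BirchSwinnertonDyer.BirchSwinnertonDyer.Theorems.AlignedTransportAtTwoSharedCubicTorsion
open Summit.BirchSwinnertonDyer.BirchSwinnertonDyer.Theorems.AlignedTransportAtTwoAlignedAtInfinityNegDisc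
open Summit.BirchSwinnertonDyer.BirchSwinnertonDyer.Theorems.AlignedTransportAtTwoAlignedAtTwoCongruence
open Summit.BirchSwinnertonDyer.BirchSwinnertonDyer.Theorems.AlignedTransportAtTwoTwistKidaCellM1

namespace Summit.BirchSwinnertonDyer.BirchSwinnertonDyer.Theorems.AlignedTransportAtTwoAlignedPairs

/-! ### Seed `10913b1` -/

/-- `Δ(10913b1) = -3743159 < 0`. [cite: CremonaAlgorithms1997, Table 1] -/
theorem Δ_neg_10913b1 : c10913b1.Δ < 0 := by
  rw [baseChange_int_Δ, M10913b1_Δ]; norm_num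

/-- `Δ(10913b1) ∉ ℚ²` (it is negative) — the seed binder of cell′. [folklore] -/
theorem not_isSquare_Δ_10913b1 : ¬ IsSquare c10913b1.Δ := by
  rintro ⟨r, hr⟩; nlinarith [mul_self_nonneg r, Δ_neg_10913b1]

/-- **`10913b1` has no CM**: `gcd(Δ, c₄) = 1` and `|Δ| > 1`, so `Δ = -3743159 ∤ c₄³ = 11713³` and `j ∉ ℤ`.
[cite: SilvermanATAEC1994, Thm. II.6.1] -/
theorem not_hasCM_10913b1 : ¬ c10913b1.HasCM :=
  OrdRedAtTwo.not_hasCM_baseChange_int_of_not_dvd_c₄_pow M10913b1 (by rw [M10913b1_Δ, M10913b1_c₄]; decide)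

/-! ### Seed `17671a1` -/

/-- `Δ(17671a1) = -724511 < 0`. [cite: CremonaAlgorithms1997, Table 1] -/
theorem Δ_neg_17671a1 : c17671a1.Δ < 0 := by
  rw [baseChange_int_Δ, M17671a1_Δ]; norm_num

/-- `Δ(17671a1) ∉ ℚ²` (it is negative) — the seed binder of cell′. [folklore] -/
theorem not_isSquare_Δ_17671a1 : ¬ IsSquare c17671a1.Δ := by
  rintro ⟨r, hr⟩; nlinarith [mul_self_nonneg r, Δ_neg_17671a1]

/-- **`17671a1` has no CM**: `gcd(Δ, c₄) = 1` and `|Δ| > 1`, so `Δ = -724511 ∤ c₄³ = -359³` and `j ∉ ℤ`.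
[cite: SilvermanATAEC1994, Thm. II.6.1] -/
theorem not_hasCM_17671a1 : ¬ c17671a1.HasCM :=
  OrdRedAtTwo.not_hasCM_baseChange_int_of_not_dvd_c₄_pow M17671a1 (by rw [M17671a1_Δ, M17671a1_c₄]; decide)

/-! ### Seed `21765d1` -/

/-- `Δ(21765d1) = -428400495 < 0`. [cite: CremonaAlgorithms1997, Table 1] -/
theorem Δ_neg_21765d1 : c21765d1.Δ < 0 := by
  rw [baseChange_int_Δ, M21765d1_Δ]; norm_num

/-- `Δ(21765d1) ∉ ℚ²` (it is negative) — the seed binder of cell′. [folklore] -/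
theorem not_isSquare_Δ_21765d1 : ¬ IsSquare c21765d1.Δ := by
  rintro ⟨r, hr⟩; nlinarith [mul_self_nonneg r, Δ_neg_21765d1]

/-- **`21765d1` has no CM**: `gcd(Δ, c₄) = 1` and `|Δ| > 1`, so `Δ = -428400495 ∤ c₄³ = 1670161³` and `j ∉ ℤ`.
[cite: SilvermanATAEC1994, Thm. II.6.1] -/
theorem not_hasCM_21765d1 : ¬ c21765d1.HasCM :=
  OrdRedAtTwo.not_hasCM_baseChange_int_of_not_dvd_c₄_pow M21765d1 (by rw [M21765d1_Δ, M21765d1_c₄]; decide)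

/-! ### Seed `29359b1` -/

/-- `Δ(29359b1) = -73848550736485943 < 0`. [cite: CremonaAlgorithms1997, Table 1] -/
theorem Δ_neg_29359b1 : c29359b1.Δ < 0 := by
  rw [baseChange_int_Δ, M29359b1_Δ]; norm_num

/-- `Δ(29359b1) ∉ ℚ²` (it is negative) — the seed binder of cell′. [folklore] -/
theorem not_isSquare_Δ_29359b1 : ¬ IsSquare c29359b1.Δ := by
  rintro ⟨r, hr⟩; nlinarith [mul_self_nonneg r, Δ_neg_29359b1]

/-- **`29359b1` has no CM**: `gcd(Δ, c₄) = 1` and `|Δ| > 1`, so `Δ = -73848550736485943 ∤ c₄³ = -3102215³` and `j ∉ ℤ`.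
[cite: SilvermanATAEC1994, Thm. II.6.1] -/
theorem not_hasCM_29359b1 : ¬ c29359b1.HasCM :=
  OrdRedAtTwo.not_hasCM_baseChange_int_of_not_dvd_c₄_pow M29359b1 (by rw [M29359b1_Δ, M29359b1_c₄]; decide)

/-! ### Seed `29359d1` -/

/-- `Δ(29359d1) = -1488589171487 < 0`. [cite: CremonaAlgorithms1997, Table 1] -/
theorem Δ_neg_29359d1 : c29359d1.Δ < 0 := by
  rw [baseChange_int_Δ, M29359d1_Δ]; norm_num

/-- `Δ(29359d1) ∉ ℚ²` (it is negative) — the seed binder of cell′. [folklore] -/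
theorem not_isSquare_Δ_29359d1 : ¬ IsSquare c29359d1.Δ := by
  rintro ⟨r, hr⟩; nlinarith [mul_self_nonneg r, Δ_neg_29359d1]

/-- **`29359d1` has no CM**: `gcd(Δ, c₄) = 1` and `|Δ| > 1`, so `Δ = -1488589171487 ∤ c₄³ = 219729³` and `j ∉ ℤ`.
[cite: SilvermanATAEC1994, Thm. II.6.1] -/
theorem not_hasCM_29359d1 : ¬ c29359d1.HasCM :=
  OrdRedAtTwo.not_hasCM_baseChange_int_of_not_dvd_c₄_pow M29359d1 (by rw [M29359d1_Δ, M29359d1_c₄]; decide)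

end Summit.BirchSwinnertonDyer.BirchSwinnertonDyer.Theorems.AlignedTransportAtTwoAlignedPairs

end
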